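import Summits.NavierStokesRegularity.NavierStokesRegularity.Theses.DssFarFieldSlaving

/-!
# Route DssFarFieldSlaving — `Assembly` (item stmt-NavierStokesRegularity-14480)

Pure-logic assembly of the conditional negative-side bridge `DssFarFieldSlaving`:
truncation bridge `B` → profile premise `H1` (Tsai's Type-I (rotated) λ-DSS Liouville conjecture
fails, unfolded one level) → Clay-class uniqueness `X5b` → `¬ NavierStokesRegularity`.

The argument is the one of the route's deciding theorem `closes`, with `X5b` kept as an explicit
hypothesis: from `B` and `H1` obtain a maximal classical Leray–Hopf solution `(u, p)` on `[0, T)`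
from a rapidly decaying datum; Clay (A) applied to the datum `u 0` gives a global smooth
bounded-energy solution `(u', p')`; `X5b` identifies `u'` with `u` on `[0, T)`; restricting
`(u', p')` to `[0, T + 1)` is a smooth extension past `T`, contradicting maximality.
-/

-- the summit and its single sub-problem share the name (CONVENTIONS §1), as in every Theorems file
set_option linter.dupNamespace false

namespace Summit.NavierStokesRegularity.NavierStokesRegularity.Theorems

open Summit.NavierStokesRegularity.NavierStokesRegularity.Theses.DssFarFieldSlaving

/-- **Assembly of route `DssFarFieldSlaving`** (item stmt-NavierStokesRegularity-14480):
`DssTruncationBridge → BlowupTypeIDssProfile → ClayUniqueness → ¬ NavierStokesRegularity`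
(all three unfolded verbatim in the statement). Pure logic: Clay (A) on the datum of the
finite-lifespan solution produced by the bridge, Clay-class uniqueness on `[0, T)`, restriction of
the global solution to `[0, T + 1)` against maximality. -/
theorem DssFarFieldSlavingAssembly_proof :
    Summit.NavierStokesRegularity.NavierStokesRegularity.Theses.DssFarFieldSlaving.Assembly := by
  unfold Assembly
  intro hB hP hU hA
  obtain ⟨ν, hν, T, hT, u, p, ⟨hcl, hmax⟩, hLH, hdec⟩ := hB hP
  have h0 : (0 : ℝ) ∈ Set.Ico 0 T := ⟨le_rfl, hT⟩
  obtain ⟨u', p', hu', hp', hns, hbe⟩ :=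
    hA ν hν (u 0) (hcl.contDiff_velocity h0) (hcl.divFree 0 h0) hdec
  have heq : ∀ t ∈ Set.Ico 0 T, u' t = u t :=
    hU ν hν (u 0) hdec u' u p' p T hT hu' hp' hns hbe hcl hLH rfl
  have hcl' : Literature.Analysis.FluidPDE.IsClassicalNSSolutionOn (Set.Ici 0) ν 0 u' p' :=
    ⟨hu', hp', fun t ht x => hns.momentum t ht x, fun t ht => hns.divFree t ht⟩
  refine hmax ⟨T + 1, by linarith, u', p', ?_, heq⟩
  exact hcl'.mono (fun t ht => ht.1) (uniqueDiffOn_Ico 0 (T + 1))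

end Summit.NavierStokesRegularity.NavierStokesRegularity.Theorems
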